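import Literature.Algebra.Homology.ContCohomologyCrossedHomKernel
import Literature.NumberTheory.GaloisRepresentations.RestrictedRamification
import Literature.NumberTheory.GaloisRepresentations.DecompositionGroupOfCompletion
import Literature.NumberTheory.GaloisRepresentations.IntegralGaloisActionProofs
import Literature.NumberTheory.GaloisRepresentations.AbsGaloisOuterConj
import Literature.NumberTheory.Automorphic.AdicCompletionLocalField
import Literature.NumberTheory.EllipticCurves.BigGaloisRepSelmer
import Summits.BirchSwinnertonDyer.Rank1Residual.X11b.SelmerTorsionControl
import HarnessLib

/-!
# Selmer classes with coefficients from `G_{K,S}` are INFLATED from `H¹(G_{K,S}, M)`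
# (glue (ii′) of route R1′ for sub-leaf W1 `Module.Finite B X₂` of K2-M♭; crux 4 `BSDpOnCellC`, stmt-BirchSwinnertonDyer-19034;
# helper, closes nothing)

Ideator bsd-idea-12 g36 (W-71/W-79: no route births, nothing registered). Theorems only (no definition, no named fact, no
`sorry`, no instance, no notation). BSD is proved for no curve; no crux / registered stub / summit statement is proved here.

Context (pricing memo `Cruxes/BSDpOnCellC/W-PRICING-n2.md`, route R1′ for W1 = `K2Weight2.stub_bigModuleFinite`): Greenberg's
Prop. 3.2 in the tree's `continuousCohomology` model (`ContinuousRep.module_finite_characterModule_continuousCohomology_of_le` with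
`hypothesisF_le_one_galoisGroupUnramifiedOutside`, Hermite) makes `(H¹(G_{K,S}, M))^∨` finitely generated for a discrete cofinitely
generated `M`; to bound the Selmer group of `Γ_K = absoluteGaloisGroup K` one needs: a class of `H¹(Γ_K, M)` (coefficients
inflated along `θ : Γ_K ↠ G_{K,S} = Γ_K ⧸ N_S`, `RestrictedRamification`) that is UNRAMIFIED at every finite `w ∉ S` in the sense of
the tree's Selmer structures (`BigGaloisRep.localMap K (Sum.inr w) : I_{K_w} → Γ_K`, image `GreenbergSelmer.inertia w`) is inflated from
`H¹(G_{K,S}, M)`. This file assembles that statement from NAMED tree results: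

* §1 (Galois): `GreenbergSelmer.inertia w ≤ N_S` for `w ∉ S` is the landed `P49Kernel.greenbergInertia_le_ramificationSubgroup`
  (`inertia_adicCompletionPrime_eq_map_absInertia`, Neukirch II (9.6), + `inertia_le_ramificationSubgroup`; used inline here, not restated);
  `inertiaOutside_subset_normalClosure` / `ramificationSubgroup_eq_closure_normalClosure` — `N_S` IS the closed normal subgroup
  generated by the `GreenbergSelmer.inertia w`, `w ∉ S` (every prime above `w` is `τ • 𝔓₀`, `exists_smul_eq_of_mem_primesAbove_holds`,
  and `I_{τ • 𝔓₀} = τ I_{𝔓₀} τ⁻¹`, `conj_mem_inertia_smul`).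
* §2 (generic): `apply_eq_zero_of_map_oneCocycleClass_eq_zero` — a restriction class that dies along `ι : I → G` after an INJECTIVE
  coefficient map to a trivially-acting module forces the crossed homomorphism to vanish on `ι(I)` (the `oneCocycleClass` /
  arbitrary-coefficient-map variant of `ContinuousCohomology.apply_eq_zero_of_map_crossedHomClass_eq_zero`, needed because the
  Selmer structures restrict through `TorsionControl.resMod`, not `𝟙`).
* §3 (inflation): `exists_pullback_eq_of_forall_inertia` — a continuous crossed homomorphism `Γ_K → M` (action through `θ`) killing
  every `GreenbergSelmer.inertia w`, `w ∉ S`, is pulled back from `G_{K,S}` (tree: density `ContinuousCohomology.apply_eq_zero_of_mem_closure_normalClosure`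
  + descent `ContinuousCohomology.crossedHom_descends_of_surjective`, `Γ_K` compact, `G_{K,S}` Hausdorff); on classes
  `exists_map_eq_of_forall_inertia`; and for the tree's Selmer groups `exists_resH1_eq_of_mem_selmer` /
  `exists_resH1_eq_of_mem_selmer_strictSet`: every class of `TorsionControl.selmer (localMap K) L (ρ.restrict θ)` with
  `Sum.inr w ∈ L` for all `w ∉ S` (for `L = strictSet p 𝔮 Σ`: all `S ⊇ Σ ∪ {w ∣ p}`) is `resH1 ρ θ y` — INFLATED from `H¹(G_{K,S}, M)`.

PARALLEL MODEL (cited, not restated): for `K M : Type` (universe 0) and the `galoisCohomology` / `localization` /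
`unramifiedSubgroup` model of a discrete `Γ_K`-module `ρ : DiscreteGaloisModule K M` unramified outside `S`, the tree proves
`DiscreteGaloisModule.mem_range_restrictedInf_of_forall_localization_mem_unramifiedSubgroup` and the Selmer-structure form
`DiscreteGaloisModule.mem_range_restrictedInf_of_mem_selmerGroup` (Literature/NumberTheory/GaloisCohomology/RestrictedRamificationUnramifiedClasses.lean,
inflation `restrictedInf` from `H¹(G_S, M^{N_S})`, local condition `loc_v c ∈ H¹_ur(K_v, M)`). The present file is the universe-polymorphic
counterpart in the model of the K2 line's Selmer groups — coefficients a `G_{K,S}`-module, inflation `TorsionControl.resH1 ρ θ`, local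
condition «restriction along the INERTIA INDEX `localMap K (Sum.inr w)` vanishes» of `TorsionControl.selmer` / `BigGaloisRep.selmerBig`
(`strictSet`) — so that W1 needs no inf–res bridge between the two local conditions.

## References
[cite: SerreGaloisCohomology1997, I §2.6 (b) (inflation–restriction)] [cite: MilneADT2006, Ch. I §4 (p. 55), Lemma 4.8] [cite: NeukirchSchmidtWingberg2008, VIII §3 (G_S = G_K/N_S)]
[cite: NeukirchANT1999, Ch. II §9 Prop. (9.6)] [cite: Greenberg2006, §3 A, Prop. 3.2 (p. 358)] [cite: Castella2018Erratum, §2 ("submodules of H¹(G_{K,S}, M_g)")]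
-/

noncomputable section

open Field IsDedekindDomain NumberField Topology
open Literature.NumberTheory.GaloisRepresentations Literature.NumberTheory.EllipticCurves
open scoped NumberField Pointwise

universe u v w

-- D-0017: single-problem summit, the namespace repeats the problem name by design.
set_option linter.dupNamespace false
set_option autoImplicit false

namespace Summit.BirchSwinnertonDyer.BirchSwinnertonDyer.Theorems.TelescopeK2SelmerInflation

/-! ## §1 `N_S` is the closed normal subgroup generated by the Selmer structure's inertia groups -/

section Galois

variable (K : Type u) [Field K] [NumberField K] (S : Set (HeightOneSpectrum (𝓞 K)))

/-- **Every inertial element outside `S` is conjugate into some `GreenbergSelmer.inertia w`, `w ∉ S`**: `inertiaOutside K S` lies in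
the normal closure of `⋃_{w ∉ S} I_w` (primes above `w` are `Γ_K`-conjugate, `exists_smul_eq_of_mem_primesAbove_holds`, and
`I_{τ • 𝔓} = τ I_𝔓 τ⁻¹`, `conj_mem_inertia_smul`). [cite: NeukirchANT1999, Ch. I §9 Prop. (9.1), Ch. II §9 Prop. (9.6)] -/
theorem inertiaOutside_subset_normalClosure :
    inertiaOutside K S ⊆
      Subgroup.normalClosure (⋃ w ∈ Sᶜ, (GreenbergSelmer.inertia w : Set (absoluteGaloisGroup K))) := by
  intro σ hσ
  rw [mem_inertiaOutside_iff] at hσ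
  obtain ⟨v, hv, 𝔓, h𝔓, hσ⟩ := hσ
  obtain ⟨τ, rfl⟩ := HeightOneSpectrum.exists_smul_eq_of_mem_primesAbove_holds
    (adicCompletionPrime_mem_primesAbove K v) h𝔓
  -- `τ⁻¹ σ τ ∈ I_{𝔓₀} = GreenbergSelmer.inertia v` (`I_{τ • 𝔓₀} = τ I_{𝔓₀} τ⁻¹`)
  have h4 : τ * (τ⁻¹ * σ * τ) * τ⁻¹ = σ := by group
  have h1 : τ⁻¹ * σ * τ ∈ GreenbergSelmer.inertia v := by
    change _ ∈ (absInertia (v.adicCompletion K)).map (absGaloisRestrict K (v.adicCompletion K)).toMonoidHom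
    rw [← inertia_adicCompletionPrime_eq_map_absInertia]
    refine (Ideal.conj_mem_inertia_smul_iff (adicCompletionPrime K v) τ (τ⁻¹ * σ * τ)).1 ?_
    rw [h4]
    exact hσ
  have h2 : τ⁻¹ * σ * τ ∈
      Subgroup.normalClosure (⋃ w ∈ Sᶜ, (GreenbergSelmer.inertia w : Set (absoluteGaloisGroup K))) :=
    Subgroup.subset_normalClosure (Set.mem_biUnion (Set.mem_compl hv) h1)
  have h3 := (Subgroup.normalClosure_normal (s := ⋃ w ∈ Sᶜ,
    (GreenbergSelmer.inertia w : Set (absoluteGaloisGroup K)))).conj_mem _ h2 τ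
  rwa [h4] at h3

/-- **`N_S = closure (normalClosure (⋃_{w ∉ S} I_w))`**: the ramification subgroup is the closed normal subgroup of `Γ_K` generated by
the Selmer structure's inertia groups outside `S`. [cite: NeukirchSchmidtWingberg2008, VIII §3] -/
theorem ramificationSubgroup_eq_closure_normalClosure :
    ramificationSubgroup K S =
      (Subgroup.normalClosure (⋃ w ∈ Sᶜ, (GreenbergSelmer.inertia w : Set (absoluteGaloisGroup K)))).topologicalClosure := by
  refine le_antisymm ?_ ?_
  · exact Subgroup.topologicalClosure_mono
      (Subgroup.normalClosure_le_normal (inertiaOutside_subset_normalClosure K S))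
  · refine Subgroup.topologicalClosure_minimal _ ?_ (ramificationSubgroup_isClosed K S)
    refine Subgroup.normalClosure_le_normal ?_
    intro σ hσ
    obtain ⟨w, hw, hσ⟩ := Set.mem_iUnion₂.mp hσ
    exact inertia_le_ramificationSubgroup hw (adicCompletionPrime_mem_primesAbove K w)
      (by rw [inertia_adicCompletionPrime_eq_map_absInertia]; exact hσ)

/-- An element of `GreenbergSelmer.inertia w`, `w ∉ S`, dies in `G_{K,S}`. [cite: NeukirchSchmidtWingberg2008, VIII §3] -/
theorem toUnramifiedQuot_eq_one_of_mem_inertia {w : HeightOneSpectrum (𝓞 K)} (hw : w ∉ S) {σ : absoluteGaloisGroup K}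
    (hσ : σ ∈ GreenbergSelmer.inertia w) : toUnramifiedQuot K S σ = 1 :=
  (QuotientGroup.eq_one_iff σ).mpr (inertia_le_ramificationSubgroup hw (adicCompletionPrime_mem_primesAbove K w)
    (by rw [inertia_adicCompletionPrime_eq_map_absInertia]; exact hσ))

/-- The image of the Selmer structure's inertia map `localMap K (Sum.inr w)` dies in `G_{K,S}` for `w ∉ S`.
[cite: NeukirchSchmidtWingberg2008, VIII §3] -/
theorem toUnramifiedQuot_localMap_inr {w : HeightOneSpectrum (𝓞 K)} (hw : w ∉ S) (i : BigGaloisRep.LocalGroup K (Sum.inr w)) :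
    toUnramifiedQuot K S (BigGaloisRep.localMap K (Sum.inr w) i) = 1 := by
  refine toUnramifiedQuot_eq_one_of_mem_inertia K S hw ?_
  rw [← BigGaloisRep.range_localMap_inr]
  exact ⟨i, rfl⟩

end Galois

/-! ## §2 A restriction class that dies forces the crossed homomorphism to vanish (arbitrary coefficient map) -/

section Local

open CategoryTheory
open scoped ContRepresentation

variable {R : Type w} [Ring R] [TopologicalSpace R]
variable {G : Type v} [Group G] [TopologicalSpace G] [IsTopologicalGroup G]
variable {I : Type v} [Group I] [TopologicalSpace I] [IsTopologicalGroup I]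

/-- **A local condition along `ι` forces pointwise vanishing on `ι(I)`.** Let `c : G → X` be a continuous crossed homomorphism,
`ι : I → G`, and `f : X|_I ⟶ Y` an INJECTIVE coefficient map to an `I`-module with TRIVIAL action. If `H¹(ι, f)[c] = 0` in `H¹(I, Y)`,
then `c ∘ ι = 0` (a coboundary `i ↦ i • y − y` for a trivial action vanishes). (`oneCocycleClass` / general-`f` form of
`ContinuousCohomology.apply_eq_zero_of_map_crossedHomClass_eq_zero`.) [cite: SerreGaloisCohomology1997, I §2.3] -/
theorem apply_eq_zero_of_map_oneCocycleClass_eq_zero (X : TopRep.{v} R G) (c : contOneCocycles X) (ι : I →ₜ* G)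
    {Y : TopRep.{v} R I} (f : TopRep.res (ι : I →* G) X ⟶ Y) (hf : Function.Injective f.hom)
    (hY : ∀ (i : I) (y : Y), Y.ρ i y = y)
    (h0 : ContinuousCohomology.map ι f 1 (oneCocycleClass X c) = 0) (i : I) : c.1 (ι i) = 0 := by
  rw [map_oneCocycleClass, oneCocycleClass_eq_zero_iff] at h0
  obtain ⟨y, hy⟩ := h0
  have h1 := hy i
  rw [contOneCocycles.pullback_apply, hY, sub_self] at h1
  exact hf (by rw [h1, map_zero])

end Local

/-! ## §3 Inflation of classes unramified outside `S` -/

section Inflation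

open CategoryTheory
open scoped ContRepresentation

variable (K : Type u) [Field K] [NumberField K] (S : Set (HeightOneSpectrum (𝓞 K)))
variable {k : Type w} [Ring k] [TopologicalSpace k]

/-- **Crossed homomorphisms killing the inertia groups outside `S` descend to `G_{K,S}`.** Let `X` be a topological `G_{K,S}`-module
with closed points and `c : Γ_K → X` a continuous crossed homomorphism for the action through `θ : Γ_K ↠ G_{K,S}` vanishing on
`GreenbergSelmer.inertia w` for every `w ∉ S`. Then `c` kills `N_S` (density: `ramificationSubgroup_eq_closure_normalClosure` +
`ContinuousCohomology.apply_eq_zero_of_mem_closure_normalClosure`) and hence is the pull-back of a continuous crossed homomorphism of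
`G_{K,S}` (`ContinuousCohomology.crossedHom_descends_of_surjective`; `Γ_K` compact, `G_{K,S}` Hausdorff).
[cite: SerreGaloisCohomology1997, I §2.6 (b)] [cite: NeukirchSchmidtWingberg2008, VIII §3] -/
theorem exists_pullback_eq_of_forall_inertia (X : TopRep.{u} k (GaloisGroupUnramifiedOutside K S)) [T1Space X]
    (c : contOneCocycles (TopRep.res (toUnramifiedQuotCont K S :
      absoluteGaloisGroup K →* GaloisGroupUnramifiedOutside K S) X))
    (hc : ∀ w ∉ S, ∀ σ ∈ GreenbergSelmer.inertia w, c.1 σ = 0) :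
    ∃ cbar : contOneCocycles X, contOneCocycles.pullback (toUnramifiedQuotCont K S) (𝟙 _) cbar = c := by
  haveI : T1Space (TopRep.res (toUnramifiedQuotCont K S :
      absoluteGaloisGroup K →* GaloisGroupUnramifiedOutside K S) X) := ‹T1Space X›
  -- `N_S` acts trivially through `θ`
  have hN : ∀ n ∈ ramificationSubgroup K S, ∀ x : (TopRep.res (toUnramifiedQuotCont K S :
      absoluteGaloisGroup K →* GaloisGroupUnramifiedOutside K S) X),
      (TopRep.res (toUnramifiedQuotCont K S : absoluteGaloisGroup K →* GaloisGroupUnramifiedOutside K S) X).ρ n x = x := by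
    intro n hn x
    have h1 : toUnramifiedQuot K S n = 1 := (QuotientGroup.eq_one_iff n).mpr hn
    change X.ρ (toUnramifiedQuot K S n) x = x
    rw [h1, map_one]
    rfl
  -- `c` kills `N_S = ker θ`
  have hker : ∀ g, toUnramifiedQuotCont K S g = 1 → c.1 g = 0 := by
    intro g hg
    have hg' : g ∈ ramificationSubgroup K S := (QuotientGroup.eq_one_iff g).mp hg
    rw [ramificationSubgroup_eq_closure_normalClosure] at hg'
    refine ContinuousCohomology.apply_eq_zero_of_mem_closure_normalClosure _ (ramificationSubgroup K S)
      (ramificationSubgroup_isClosed K S) hN c.1 c.2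
      (T := ⋃ w ∈ Sᶜ, (GreenbergSelmer.inertia w : Set (absoluteGaloisGroup K))) ?_ ?_ hg'
    · intro σ hσ
      obtain ⟨w, hw, hσ⟩ := Set.mem_iUnion₂.mp hσ
      exact inertia_le_ramificationSubgroup hw (adicCompletionPrime_mem_primesAbove K w)
        (by rw [inertia_adicCompletionPrime_eq_map_absInertia]; exact hσ)
    · intro σ hσ
      obtain ⟨w, hw, hσ⟩ := Set.mem_iUnion₂.mp hσ
      exact hc w hw σ hσ
  -- descend
  obtain ⟨Fb, hFb, hFbθ⟩ := ContinuousCohomology.crossedHom_descends_of_surjective (toUnramifiedQuotCont K S)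
    (toUnramifiedQuot_surjective K S) X c.1 c.2 hker
  refine ⟨⟨Fb, hFb⟩, Subtype.ext (ContinuousMap.ext fun g => ?_)⟩
  rw [contOneCocycles.pullback_apply]
  exact hFbθ g

/-- **Classes unramified outside `S` are inflated** (class form): a class of `H¹(Γ_K, X)` (coefficients through `θ`) whose restriction
along every inertia map `localMap K (Sum.inr w)`, `w ∉ S`, vanishes is in the image of the inflation `H¹(G_{K,S}, X) → H¹(Γ_K, X)`.
[cite: SerreGaloisCohomology1997, I §2.6 (b)] [cite: Castella2018Erratum, §2] -/
theorem exists_map_eq_of_forall_inertia (X : TopRep.{u} k (GaloisGroupUnramifiedOutside K S)) [T1Space X]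
    (x : continuousCohomology 1 (TopRep.res (toUnramifiedQuotCont K S :
      absoluteGaloisGroup K →* GaloisGroupUnramifiedOutside K S) X))
    (hx : ∀ w ∉ S, ContinuousCohomology.map (BigGaloisRep.localMap K (Sum.inr w)) (𝟙 _) 1 x = 0) :
    ∃ y : continuousCohomology 1 X, ContinuousCohomology.map (toUnramifiedQuotCont K S) (𝟙 _) 1 y = x := by
  obtain ⟨c, rfl⟩ := oneCocycleClass_surjective _ x
  have hc : ∀ w ∉ S, ∀ σ ∈ GreenbergSelmer.inertia w, c.1 σ = 0 := by
    intro w hw σ hσ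
    rw [← BigGaloisRep.range_localMap_inr] at hσ
    obtain ⟨i, rfl⟩ := hσ
    refine apply_eq_zero_of_map_oneCocycleClass_eq_zero _ c (BigGaloisRep.localMap K (Sum.inr w)) (𝟙 _)
      (fun a b h ↦ h) (fun j y ↦ ?_) (hx w hw) i
    have h1 : toUnramifiedQuot K S (BigGaloisRep.localMap K (Sum.inr w) j) = 1 :=
      toUnramifiedQuot_localMap_inr K S hw j
    change X.ρ (toUnramifiedQuot K S (BigGaloisRep.localMap K (Sum.inr w) j)) y = y
    rw [h1, map_one]
    rfl
  obtain ⟨cbar, hcbar⟩ := exists_pullback_eq_of_forall_inertia K S X c hc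
  exact ⟨oneCocycleClass X cbar, by rw [map_oneCocycleClass, hcbar]⟩

open Summit.BirchSwinnertonDyer.Rank1Residual.X11b.TorsionControl

variable {A : Type*} [CommRing A] [TopologicalSpace A]
variable {M : Type u} [AddCommGroup M] [Module A M] [TopologicalSpace M] [DiscreteTopology M] [ContinuousSMul A M]

/-- **Selmer classes are inflated from `H¹(G_{K,S}, M)`.** Let `ρ` be a continuous representation of `G_{K,S}` on a discrete `M`
and `L` a set of local indices containing the inertia index `Sum.inr w` for every finite `w ∉ S`. Then every class of the Selmer group
`TorsionControl.selmer (localMap K) L (ρ.restrict θ) ⊆ H¹(Γ_K, M)` is of the form `resH1 ρ θ y` with `y ∈ H¹(G_{K,S}, M)` — the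
«submodule of `H¹(G_{K,S}, M)`» reading of the erratum's Selmer groups, from which `Sel^∨` is a quotient of a submodule's dual of
`H¹(G_{K,S}, M)^∨` (Greenberg Prop. 3.2 then bounds it). [cite: Castella2018Erratum, §2] [cite: Greenberg2006, §3 A, Prop. 3.2] -/
theorem exists_resH1_eq_of_mem_selmer (ρ : ContinuousRep (GaloisGroupUnramifiedOutside K S) A M)
    (L : Set (BigGaloisRep.LocalIndex K)) (hL : ∀ w ∉ S, (Sum.inr w : BigGaloisRep.LocalIndex K) ∈ L)
    {x : continuousCohomology 1 (ρ.restrict (toUnramifiedQuotCont K S)).toTopRep}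
    (hx : x ∈ selmer (BigGaloisRep.localMap K) L (ρ.restrict (toUnramifiedQuotCont K S))) :
    ∃ y : continuousCohomology 1 ρ.toTopRep, resH1 ρ (toUnramifiedQuotCont K S) y = x := by
  rw [mem_selmer_iff] at hx
  obtain ⟨c, rfl⟩ := oneCocycleClass_surjective _ x
  have hc : ∀ w ∉ S, ∀ σ ∈ GreenbergSelmer.inertia w, c.1 σ = 0 := by
    intro w hw σ hσ
    rw [← BigGaloisRep.range_localMap_inr] at hσ
    obtain ⟨i, rfl⟩ := hσ
    refine apply_eq_zero_of_map_oneCocycleClass_eq_zero _ c (BigGaloisRep.localMap K (Sum.inr w))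
      (resMod (ρ.restrict (toUnramifiedQuotCont K S)) (BigGaloisRep.localMap K (Sum.inr w)))
      (fun a b h ↦ h) (fun j y ↦ ?_) (hx _ (hL w hw)) i
    have h1 : toUnramifiedQuot K S (BigGaloisRep.localMap K (Sum.inr w) j) = 1 :=
      toUnramifiedQuot_localMap_inr K S hw j
    change ρ (toUnramifiedQuot K S (BigGaloisRep.localMap K (Sum.inr w) j)) y = y
    rw [h1, map_one]
    rfl
  obtain ⟨cbar, hcbar⟩ := exists_pullback_eq_of_forall_inertia K S ρ.toTopRep c hc
  refine ⟨oneCocycleClass _ cbar, ?_⟩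
  rw [map_oneCocycleClass]
  -- `pullback θ (resMod ρ θ) cbar = pullback θ (𝟙 _) cbar = c` (`resMod` is the identity of `M`)
  exact congrArg (oneCocycleClass _) hcbar

/-- **Selmer classes for `strictSet` are inflated from `H¹(G_{K,S}, M)` whenever `S ⊇ Σ ∪ {w ∣ p}`**: the Selmer structure
`strictSet p 𝔮 Σ` of [Cas18, Def. 2.2] / erratum §2 imposes the inertia condition exactly at the finite `w ∉ Σ` with `w ∤ p`
(`inr_mem_strictSet_iff`), so for any `S` containing `Σ` and the primes above `p` every class of
`TorsionControl.selmer (localMap K) (strictSet p 𝔮 Σ) (ρ.restrict θ)` is inflated from `G_{K,S}`.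
[cite: Castella2018Erratum, §2] [cite: Castella2018, Def. 2.2 (p. 4)] -/
theorem exists_resH1_eq_of_mem_selmer_strictSet (ρ : ContinuousRep (GaloisGroupUnramifiedOutside K S) A M)
    (p : ℕ) (𝔮 : HeightOneSpectrum (𝓞 K)) (Sig : Set (HeightOneSpectrum (𝓞 K)))
    (hS : ∀ w, w ∉ S → w ∉ Sig ∧ ((p : ℕ) : 𝓞 K) ∉ w.asIdeal)
    {x : continuousCohomology 1 (ρ.restrict (toUnramifiedQuotCont K S)).toTopRep}
    (hx : x ∈ selmer (BigGaloisRep.localMap K) (BigGaloisRep.strictSet p 𝔮 Sig)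
      (ρ.restrict (toUnramifiedQuotCont K S))) :
    ∃ y : continuousCohomology 1 ρ.toTopRep, resH1 ρ (toUnramifiedQuotCont K S) y = x :=
  exists_resH1_eq_of_mem_selmer K S ρ (BigGaloisRep.strictSet p 𝔮 Sig)
    (fun w hw ↦ (BigGaloisRep.inr_mem_strictSet_iff p 𝔮 w Sig).mpr (hS w hw)) hx

end Inflation

end Summit.BirchSwinnertonDyer.BirchSwinnertonDyer.Theorems.TelescopeK2SelmerInflation

end
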